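import Summits.ValiantsHypothesis.ValiantsHypothesis.Theorems.DivisionGapZeroOneTransferProjClosureAux
import Literature.Computability.AlgebraicComplexity.ValiantClassesProofs

/-!
# Crux `ZeroOneTransfer` (stmt-ValiantsHypothesis-5066), line `arborescence-span` —
stub `stub_projClosure`: division certificates transport along Valiant projections over `ℝ≥0`,
zero constants included, at no cost

`stub_projClosure`: for `q = p(a)` a Valiant projection of `p ∈ ℝ≥0[ι]` (`a i ∈ {X j} ∪ {C c}`,
the constant `0` ALLOWED) and every nonzero `h ∈ ℝ≥0[ι]` there is a nonzero `h' ∈ ℝ≥0[τ]` with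
`L(q h') + L(h') ≤ L(p h) + L(h)`, `L` the tree's fan-in-two `complexity` over the semiring `ℝ≥0`.
Equivalently the Hrubeš–Yehudayoff division complexity `min_{h ≠ 0} L(f h) + L(h)` is monotone
under projections; the line uses it as `IsProjection q ST_N → divC q ≤ divC ST_N`.

## Proof (part 2 of 2; part 1 is `DivisionGapZeroOneTransferProjClosureAux.lean`)

Let `Z := {i | a i = 0}`, let `w` be the indicator weight of `Z` (the `w`-weight of a monomial is
its degree in the `Z`-variables) and let `a'` be the nowhere-zero companion of `a` (`a' i = 1` on
`Z`, `a' i = a i` off `Z`); `a'` substitutes variables and NONZERO constants.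

* `aeval_eq_aeval_whc` — `p(a) = (p|_{w = 0})(a')`: the monomials with a `Z`-variable die under
  `a`, the others do not see the difference between `a` and `a'`.
* If `botDegree w p ≠ 0` (every monomial of `p` has a `Z`-variable) then `q = p(a) = 0`, and any
  nonzero `h'` with `L(h') ≤ L(h)` works since `L(0) = 0`.
* Otherwise `p|_{w = 0} = bot_w p` is the BOTTOM `w`-component of `p`, and over `ℝ≥0` (no
  cancellation, no zero divisors; part 1, registered sub-stub `stub_projClosure_botFree`)
  `bot_w (p h) = bot_w p · bot_w h`, `bot_w h ≠ 0`, and bottom forms are free: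
  `L(bot_w r) ≤ L(r)` (`complexity_botComponent_le`, gate-by-gate pruning).  Put
  `h' := (bot_w h)(a')`: it is nonzero because `a'` is positive (`aeval_ne_zero_of_pos'`, evaluate
  at the all-ones point), `q h' = (bot_w (p h))(a')`, and projections are free
  (`complexity_le_of_isProjection`), so
  `L(q h') + L(h') ≤ L(bot_w (p h)) + L(bot_w h) ≤ L(p h) + L(h)`.

Helper namespace `ProjClosure`; no definitions (the weight `w` and the companion `a'` are
hypotheses `hw`, `ha'`, instantiated in `stub_projClosure`).  Imports: part 1 and `Literature`
only (no `Theses` file), so three short lemmas of `Negative/Faces.lean` are re-proved (primed).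
[folklore]
-/

noncomputable section

-- `Summit.ValiantsHypothesis.ValiantsHypothesis.…` is the tree's mandated single-conjunct layout
-- (Sub = Summit), so the duplicated namespace component is intended.
set_option linter.dupNamespace false

namespace Summit.ValiantsHypothesis.ValiantsHypothesis.Theorems.DivisionGapZeroOneTransfer

open Literature.Computability.AlgebraicComplexity
open MvPolynomial Finset
open scoped NNReal

namespace ProjClosure

variable {ι τ : Type*}

/-! ### Positive substitutions keep nonzero polynomials nonzero over `ℝ≥0` -/

/-- Evaluation commutes with substitution (twin of `ZeroOneTransfer.Negative.eval_aeval_eq` of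
`Negative/Faces.lean`; that module imports the route thesis `Theses.DivisionGap`, whereas this
file deliberately imports only `Literature` and part 1, hence the three re-proved twins).
[folklore] -/
theorem eval_aeval_eq' {R : Type*} [CommSemiring R] (x : τ → R) (e : ι → MvPolynomial τ R)
    (p : MvPolynomial ι R) : eval x (aeval e p) = eval (fun i => eval x (e i)) p := by
  induction p using MvPolynomial.induction_on with
  | C a => simp
  | add p q hp hq => rw [map_add, map_add, hp, hq, map_add]
  | mul_X p i hp => rw [map_mul, map_mul, hp, aeval_X, map_mul, eval_X]

/-- Over `ℝ≥0` a nonzero polynomial does not vanish at a point with nonzero coordinates (twin of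
`ZeroOneTransfer.Negative.eval_ne_zero_of_ne_zero`, `Negative/Faces.lean`). [folklore] -/
theorem eval_ne_zero_of_ne_zero' {p : MvPolynomial ι ℝ≥0} (hp : p ≠ 0) {y : ι → ℝ≥0}
    (hy : ∀ i, y i ≠ 0) : eval y p ≠ 0 := by
  classical
  obtain ⟨d, hd⟩ := exists_coeff_ne_zero hp
  rw [eval_eq]
  intro h0
  have hterm : coeff d p * ∏ i ∈ d.support, y i ^ d i ≠ 0 :=
    mul_ne_zero hd (Finset.prod_ne_zero_iff.mpr fun i _ => pow_ne_zero _ (hy i))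
  have hle : coeff d p * ∏ i ∈ d.support, y i ^ d i ≤
      ∑ e ∈ p.support, coeff e p * ∏ i ∈ e.support, y i ^ e i :=
    Finset.single_le_sum (f := fun e => coeff e p * ∏ i ∈ e.support, y i ^ e i)
      (fun _ _ => zero_le) (mem_support_iff.mpr hd)
  rw [h0] at hle
  exact hterm (le_antisymm hle zero_le)

/-- A POSITIVE substitution (variables, or NONZERO constants) keeps nonzero polynomials nonzero
over `ℝ≥0`: evaluate at the all-ones point (twin of
`ZeroOneTransfer.Negative.aeval_ne_zero_of_pos`, `Negative/Faces.lean`). [folklore] -/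
theorem aeval_ne_zero_of_pos' (e : ι → MvPolynomial τ ℝ≥0)
    (he : ∀ i, (∃ j, e i = X j) ∨ ∃ c : ℝ≥0, c ≠ 0 ∧ e i = C c)
    {p : MvPolynomial ι ℝ≥0} (hp : p ≠ 0) : aeval e p ≠ 0 := by
  intro h0
  have h1 : eval (fun _ => (1 : ℝ≥0)) (aeval e p) = 0 := by rw [h0, map_zero]
  rw [eval_aeval_eq'] at h1
  refine eval_ne_zero_of_ne_zero' hp (y := fun i => eval (fun _ => (1 : ℝ≥0)) (e i)) ?_ h1
  intro i
  rcases he i with ⟨j, hj⟩ | ⟨c, hc, hci⟩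
  · rw [hj, eval_X]; exact one_ne_zero
  · rw [hci, eval_C]; exact hc

/-! ### Splitting a projection into its zero part and a positive substitution -/

/-- Weighted homogeneous components of a monomial. [folklore] -/
theorem weightedHomogeneousComponent_monomial (w : ι → ℕ) (n : ℕ) (d : ι →₀ ℕ) (c : ℝ≥0) :
    weightedHomogeneousComponent w n (monomial d c) =
      if Finsupp.weight w d = n then monomial d c else 0 := by
  split_ifs with h
  · exact (isWeightedHomogeneous_monomial w d c h).weightedHomogeneousComponent_same
  · refine weightedHomogeneousComponent_eq_zero' n _ fun e he => ?_
    rwa [Finset.mem_singleton.mp (support_monomial_subset he)]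

variable {a a' : ι → MvPolynomial τ ℝ≥0} {w : ι → ℕ}

/-- For `w` the indicator of `Z = {i | a i = 0}`: a monomial has `w`-weight `0` iff none of its
variables lies in `Z`. [folklore] -/
theorem weight_eq_zero_iff (hw : ∀ i, w i = 0 ↔ a i ≠ 0) (d : ι →₀ ℕ) :
    Finsupp.weight w d = 0 ↔ ∀ i ∈ d.support, a i ≠ 0 := by
  classical
  rw [Finsupp.weight_apply, Finsupp.sum, Finset.sum_eq_zero_iff]
  refine forall₂_congr fun i hi => ?_
  rw [smul_eq_mul, mul_eq_zero, or_iff_right (Finsupp.mem_support_iff.mp hi), hw]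

/-- **`p(a) = (p|_{w = 0})(a')`** for `w` the indicator of `Z = {i | a i = 0}` and `a'` agreeing
with `a` off `Z`: monomials with a `Z`-variable die under `a`, the others do not distinguish `a`
from `a'`. [folklore] -/
theorem aeval_eq_aeval_whc (hw : ∀ i, w i = 0 ↔ a i ≠ 0) (ha' : ∀ i, a i ≠ 0 → a' i = a i)
    (r : MvPolynomial ι ℝ≥0) :
    aeval a r = aeval a' (weightedHomogeneousComponent w 0 r) := by
  classical
  induction r using MvPolynomial.induction_on' with
  | monomial d c =>
    rw [weightedHomogeneousComponent_monomial, aeval_monomial, Finsupp.prod]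
    split_ifs with hd
    · rw [aeval_monomial, Finsupp.prod]
      congr 1
      exact Finset.prod_congr rfl fun i hi => by rw [ha' i ((weight_eq_zero_iff hw d).mp hd i hi)]
    · obtain ⟨i, hi, hai⟩ : ∃ i ∈ d.support, a i = 0 := by
        by_contra hcon
        exact hd ((weight_eq_zero_iff hw d).mpr fun i hi h0 => hcon ⟨i, hi, h0⟩)
      have hz : a i ^ d i = 0 := by rw [hai]; exact zero_pow (Finsupp.mem_support_iff.mp hi)
      rw [map_zero, Finset.prod_eq_zero hi hz, mul_zero]
  | add p q hp hq => rw [map_add, map_add, map_add, hp, hq]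

/-- If some monomial of `r` has no `Z`-variable then `r(a) = (bot_w r)(a')`. [folklore] -/
theorem aeval_eq_aeval_botComponent (hw : ∀ i, w i = 0 ↔ a i ≠ 0)
    (ha' : ∀ i, a i ≠ 0 → a' i = a i) {r : MvPolynomial ι ℝ≥0} (hr : botDegree w r = 0) :
    aeval a r = aeval a' (botComponent w r) := by
  rw [aeval_eq_aeval_whc hw ha', botComponent, hr]

/-- If every monomial of `r` has a `Z`-variable then `r(a) = 0`. [folklore] -/
theorem aeval_eq_zero_of_botDegree_ne_zero (hw : ∀ i, w i = 0 ↔ a i ≠ 0)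
    {r : MvPolynomial ι ℝ≥0} (hr : botDegree w r ≠ 0) : aeval a r = 0 := by
  rw [aeval_eq_aeval_whc hw (a' := a) (fun _ _ => rfl), weightedHomogeneousComponent_eq_zero',
    map_zero]
  intro d hd h0
  exact hr (Nat.eq_zero_of_le_zero (h0 ▸ botDegree_le _ hd))

/-- `L(0) = 0` (a gate-free circuit). [folklore] -/
theorem complexity_zero : complexity (0 : MvPolynomial τ ℝ≥0) = 0 := by
  rw [← C_0]; exact complexity_C_holds 0

/-- **Main lemma.** For `a`, the indicator weight `w` of `Z = {i | a i = 0}` and a POSITIVE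
substitution `a'` agreeing with `a` off `Z`: for every nonzero cofactor `h` the cofactor
`h' := (bot_w h)(a')` is nonzero and `L(p(a) · h') + L(h') ≤ L(p h) + L(h)`. [folklore] -/
theorem exists_cofactor (hw : ∀ i, w i = 0 ↔ a i ≠ 0) (ha' : ∀ i, a i ≠ 0 → a' i = a i)
    (hpos : ∀ i, (∃ j, a' i = X j) ∨ ∃ c : ℝ≥0, c ≠ 0 ∧ a' i = C c)
    (p : MvPolynomial ι ℝ≥0) {h : MvPolynomial ι ℝ≥0} (hh : h ≠ 0) :
    ∃ h' : MvPolynomial τ ℝ≥0, h' ≠ 0 ∧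
      complexity (aeval a p * h') + complexity h' ≤ complexity (p * h) + complexity h := by
  have hfree : ∀ r : MvPolynomial ι ℝ≥0, complexity (aeval a' r) ≤ complexity r := fun r =>
    complexity_le_of_isProjection ⟨a', fun i => (hpos i).imp id (fun ⟨c, _, hc⟩ => ⟨c, hc⟩), rfl⟩
  refine ⟨aeval a' (botComponent w h),
    aeval_ne_zero_of_pos' a' hpos (botComponent_ne_zero w hh), ?_⟩
  have h2 : complexity (aeval a' (botComponent w h)) ≤ complexity h :=
    (hfree _).trans (complexity_botComponent_le w h)
  by_cases hbd : botDegree w p = 0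
  · calc complexity (aeval a p * aeval a' (botComponent w h)) +
          complexity (aeval a' (botComponent w h))
        = complexity (aeval a' (botComponent w (p * h))) +
          complexity (aeval a' (botComponent w h)) := by
          rw [aeval_eq_aeval_botComponent hw ha' hbd, ← map_mul, ← botComponent_mul]
      _ ≤ complexity (p * h) + complexity h :=
          Nat.add_le_add ((hfree _).trans (complexity_botComponent_le w _)) h2
  · rw [aeval_eq_zero_of_botDegree_ne_zero hw hbd, zero_mul, complexity_zero, zero_add]
    exact h2.trans (Nat.le_add_left _ _)

end ProjClosure

/-- **stub `stub_projClosure` — projection closure with zeros** (card lemma A1 of line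
`arborescence-span`, zero labels included): every division certificate of `p` transports along a
Valiant projection `q = p(a)`, `a i ∈ {X j} ∪ {C c}` (the constant `0` allowed), at no cost —
for every nonzero `h` there is a nonzero `h'` with `L(q h') + L(h') ≤ L(p h) + L(h)`, `L` the
fan-in-two circuit size over the semiring `ℝ≥0`.  Proof: `ProjClosure.exists_cofactor` with `w`
the indicator of `Z = {i | a i = 0}` and `a' = a` off `Z`, `a' = 1` on `Z`. [folklore] -/
theorem stub_projClosure :
    ∀ (ι τ : Type) (p : MvPolynomial ι NNReal) (q : MvPolynomial τ NNReal),
      Literature.Computability.AlgebraicComplexity.IsProjection q p →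
      ∀ h : MvPolynomial ι NNReal, h ≠ 0 →
        ∃ h' : MvPolynomial τ NNReal, h' ≠ 0 ∧
          Literature.Computability.AlgebraicComplexity.complexity (q * h') +
              Literature.Computability.AlgebraicComplexity.complexity h' ≤
            Literature.Computability.AlgebraicComplexity.complexity (p * h) +
              Literature.Computability.AlgebraicComplexity.complexity h := by
  intro ι τ p q hqp h hh
  obtain ⟨a, ha, rfl⟩ := hqp
  classical
  refine ProjClosure.exists_cofactor (w := fun i => if a i = 0 then 1 else 0)
    (a' := fun i => if a i = 0 then 1 else a i) (fun i => by simp) (fun i hi => if_neg hi)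
    (fun i => ?_) p hh
  by_cases h0 : a i = 0
  · exact Or.inr ⟨1, one_ne_zero, by rw [if_pos h0, C_1]⟩
  · rcases ha i with ⟨j, hj⟩ | ⟨c, hc⟩
    · exact Or.inl ⟨j, by rw [if_neg h0, hj]⟩
    · exact Or.inr ⟨c, fun hc0 => h0 (by rw [hc, hc0, C_0]), by rw [if_neg h0, hc]⟩

end Summit.ValiantsHypothesis.ValiantsHypothesis.Theorems.DivisionGapZeroOneTransfer
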